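import Literature.Computability.Cryptography.RegevReductionCVPqProgramsAssembly
import Literature.Computability.Cryptography.RegevSamplerArithFP
import Literature.Computability.Complexity.CodeFPTableKit
import Literature.Computability.Complexity.CodeFPStrings
import Literature.Computability.Complexity.CodeFPLists
import Literature.Computability.Complexity.CodeFPRat
import Literature.Computability.QuantumComplexity.HidingProgramMachine
import HarnessLib

/-!
# Regev's CVP_q programs, II: one block of manufactured LWE samples as a list program

HONEST FRAMING. Part of a first formalisation of a KNOWN reduction (Regev 2009, worst-case
GapSVP/SIVP ≤ LWE, classical part). The value is a THEOREM about that reduction (plumbing: the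
block-manufacture arithmetic of Regev's `CVP_q` procedure — shift chunks, coarse and fine samples with
integer noise read off coin words by a sampler program, the secret shift — is an explicit LIST PROGRAM,
polynomial-time in the tree's typed `CodeFP` algebra, and it computes exactly the residues of the tree's
`blockOfBits` / `shiftSample` data). It is NOT progress on any open problem and breaks nothing.

## What is proved

* `shiftL`, `coarseL`, `fineL`, `sampleListL`, `blockL`, `shiftedL` — list-level mirrors (residues as
  naturals `< q`, lattice vectors by their row-basis coordinates, the `N₀ t_j` as a list) of
  `shiftOfBits`, `coarseOfNoise`, `fineOfNoise`, `blockOfBits`, `shiftSample`;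
* `blockL_eq` — on genuine data the list program returns the residues of `blockOfBits` (all three
  components), `shiftedL_ofFn` — the shifted coarse batch, `encodeLWESamples_eq` — the LWE code of a
  batch is the typed code of its residue lists;
* `codeFP_blockL`, `codeFP_shiftedL` (given `samp ∈ FP`) — the programs are polynomial-time.

## Sources

Regev 2009 (J. ACM 56(6):34; pages from arXiv:2401.03703): Lemma 3.11 p. 18 with Eq. (10) (the samples
`(L⁻¹v mod q, ⌊(N₀⟨x,v⟩ + e + N₀/2)/N₀⌋ mod q)`), Lemma 3.7 p. 16 (fine samples at modulus `qK`), Lemma 4.1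
(the unknown `s` is shifted). Arora–Barak 2009 §1.3 (closure of polynomial time), Def. 7.1 (coins).
-/

noncomputable section

namespace Literature.Computability.Cryptography

namespace Regev2009

namespace CVPqProg

open _root_.Computability Literature.Computability.Complexity Literature.Computability.Complexity.CodeFP
  Literature.Computability.Complexity.Brick Literature.Algebra.EuclideanLattices Polynomial Finset
  Literature.LinearAlgebra.Matrix Literature.LinearAlgebra.Matrix.Berkowitz Literature.LinearAlgebra.Matrix.RowSelect
  Literature.Computability.Complexity.RowSelectFP Peikert2009 LWE DigitOracle

variable {α β γ σ : Type} {eα : α → List Bool} {eβ : β → List Bool} {eσ : σ → List Bool}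

/-! ### Small list lemmas -/

/-- Residue of an integer cast. [folklore] -/
theorem val_intCast_eq (q : ℕ) [NeZero q] (z : ℤ) : ((z : ZMod q)).val = (z % (q : ℤ)).toNat := by
  have h : (((z : ZMod q)).val : ℤ) = z % (q : ℤ) := ZMod.val_intCast z
  rw [← h, Int.toNat_natCast]

/-- The dot product of natural lists (truncating). [folklore] -/
def dotN (u v : List ℕ) : ℕ := (List.zipWith (· * ·) u v).sum

/-- `dotN` of two `ofFn`. [folklore] -/
theorem dotN_ofFn {n : ℕ} (f g : Fin n → ℕ) : dotN (List.ofFn f) (List.ofFn g) = ∑ i, f i * g i := by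
  rw [dotN, zipWith_ofFn, List.sum_ofFn]

/-- `dotN` on codes. [cite: AroraBarak2009, §1.3] -/
theorem codeFP_dotN : CodeFP (pairE (rawE natE) (rawE natE)) natE (fun p => dotN p.1 p.2) := by
  have hz := zipWith (σ := Unit) (eσ := unitE) (eα := natE) (eβ := natE) (eγ := natE)
    (g := fun t : Unit × ℕ × ℕ => t.2.1 * t.2.2) (natMul.comp (snd _ _))
  exact (natSum.comp (hz.comp ((const _ ()).pair (CodeFP.id _)))).congr fun _ => rfl

/-- **The residue of a shifted right-hand side** `b + ⟨a, s⟩`. [cite: RegevLWE2009, Lemma 4.1 (proof)] -/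
theorem val_add_dotProduct {n q : ℕ} [NeZero q] (a s : Fin n → ZMod q) (b : ZMod q) :
    (b + a ⬝ᵥ s).val = (b.val + ∑ i, (a i).val * (s i).val) % q := by
  have : b + a ⬝ᵥ s = ((b.val + ∑ i, (a i).val * (s i).val : ℕ) : ZMod q) := by
    push_cast
    simp [dotProduct]
  rw [this, ZMod.val_natCast]

/-! ### The shift read off a coin word -/

/-- The residues of the shift: binary values of the `n` chunks of width `ℓ`, mod `q`.
[cite: RegevLWE2009, Lemma 3.11 (proof)] -/
def shiftL (n q ℓ : ℕ) (r : List Bool) : List ℕ := List.ofFn fun i : Fin n => bitsToNat (chunk ℓ r i) % q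

/-- `shiftL` lists the residues of `shiftOfBits`. [folklore] -/
theorem shiftL_eq_ofFn (n q ℓ : ℕ) (r : List Bool) :
    shiftL n q ℓ r = List.ofFn fun i => (shiftOfBits n q ℓ r i).val := by
  rw [shiftL]
  congr 1; funext i
  rw [shiftOfBits, chunkVal, ZMod.val_natCast]

/-- `shiftL` on codes `((1ⁿ, q), (1^ℓ, r))`. [cite: AroraBarak2009, §1.3] -/
theorem codeFP_shiftL : CodeFP (pairE (pairE unE natE) (pairE unE strE)) (rawE natE)
    (fun p => shiftL p.1.1 p.1.2 p.2.1 p.2.2) := by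
  have hch : CodeFP (pairE (pairE unE natE) (pairE unE strE)) (rawE strE)
      (fun p => (List.range p.1.1).map fun i => (p.2.2.drop (i * p.2.1)).take p.2.1) :=
    strChunks.comp ((fst _ _).fst'.pair (snd _ _))
  have hg : CodeFP (pairE natE strE) natE (fun t => bitsToNat t.2 % t.1) :=
    natMod.comp ((strVal.comp (snd _ _)).pair (fst _ _))
  refine (((map (σ := ℕ) (eσ := natE) (eα := strE) (g := fun t => bitsToNat t.2 % t.1) hg).comp
    ((fst _ _).snd'.pair hch)).congr fun p => ?_)
  rw [shiftL, List.map_map]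
  apply List.ext_getElem (by simp)
  intro i h₁ h₂
  simp [chunk, Nat.mul_comm]

/-! ### One noise value: the sampler program on its parameter string and a coin word -/

/-- The code of the sampler parameters is the tree's parameter string. [folklore] -/
theorem sampParams_eq (M : ℕ) (s : ℚ) (ℓ : ℕ) : sampParams M s ℓ = pairE natE (pairE encodeRat unE) (M, s, ℓ) := rfl

/-- Mathlib's total `decodeBool` reads the first bit (`false` on `ε`). [folklore] -/
theorem decodeBool_eq_getD (w : List Bool) : decodeBool w = w.getD 0 false := by
  cases w <;> rfl

/-- `decodeBool` is polynomial-time on all strings. [cite: AroraBarak2009, §1.3] -/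
theorem codeFP_decodeBool : CodeFP strE bitE decodeBool :=
  (strGetD.comp ((const strE (eβ := unE) (0 : ℕ)).pair (CodeFP.id strE))).congr fun w =>
    (decodeBool_eq_getD w).symm

/-- Unfolding the total signed decoder: sign bit of the first field, magnitude of the second.
[folklore] -/
theorem decodeIntD_eq (w : List Bool) :
    decodeIntD w = if decodeBool (fstF w) then -(decodeNat (sndF w) : ℤ) else (decodeNat (sndF w) : ℤ) := by
  simp [decodeIntD, encodingIntBool, Encoding.pairBool, encodingBoolBool, encodingNatBool, fstF, sndF]

/-- **The total signed decoder `decodeIntD` is polynomial-time on all strings** (the bricks `fstF`,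
`sndF` and the canonical re-coding `canonF = natE ∘ decodeNat` are inlined). [cite: AroraBarak2009, §1.3] -/
theorem codeFP_decodeIntD : CodeFP strE intE decodeIntD := by
  have hs : CodeFP strE bitE (fun w => decodeBool (fstF w)) :=
    codeFP_decodeBool.comp (of_fn fstF fstF_mem_FP fun _ => rfl : CodeFP strE strE fstF)
  have hm : CodeFP strE intE (fun w => (decodeNat (sndF w) : ℤ)) :=
    intOfNat.comp ((of_fn canonF canonF_mem_FP fun w => canonF_eq_encodeNat_decodeNat w : CodeFP strE natE decodeNat).comp
      (of_fn sndF sndF_mem_FP fun _ => rfl : CodeFP strE strE sndF))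
  exact (hs.ite (intNeg.comp hm) hm).congr fun w => (decodeIntD_eq w).symm

/-- **A noise value is polynomial-time in `((M, s, 1^ℓ), word)`** when the sampler is.
[cite: AroraBarak2009, §1.3 (composition)] -/
theorem codeFP_noise {samp : List Bool → List Bool} (hsamp : samp ∈ FP) :
    CodeFP (pairE (pairE natE (pairE encodeRat unE)) strE) intE
      (fun p => noiseOfBits samp p.1.1 p.1.2.1 p.1.2.2 p.2) := by
  have hs : CodeFP (pairE (pairE natE (pairE encodeRat unE)) strE) strE
      (fun p => samp (boolPair (sampParams p.1.1 p.1.2.1 p.1.2.2) p.2)) :=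
    of_fn samp hsamp fun _ => rfl
  exact (codeFP_decodeIntD.comp hs).congr fun _ => rfl

/-! ### Coarse and fine samples from row-basis coordinates -/

/-- Residues of an integer vector mod `q`. [folklore] -/
def cmodL (q : ℕ) (c : List ℤ) : List ℕ := c.map fun z => (z % (q : ℤ)).toNat

/-- **The coarse sample** from coordinates `c`, the scaled point `scl = (N₀ t_j)_j`, noise `e`:
`(c mod q, ⌊(⟨scl, c⟩ + e + N/2)/N⌋ mod q)` as residues. [cite: RegevLWE2009, Lemma 3.11 (proof, Eq. (10))] -/
def coarseL (q N : ℕ) (scl c : List ℤ) (e : ℤ) : List ℕ × ℕ :=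
  (cmodL q c, (((idot scl c + e + (N / 2 : ℕ)) / (N : ℤ)) % (q : ℤ)).toNat)

/-- **The fine sample** (modulus `qK`). [cite: RegevLWE2009, Lemma 3.7 (proof)] -/
def fineL (q K N : ℕ) (scl c : List ℤ) (e : ℤ) : List ℕ × ℕ :=
  (cmodL q c, ((((K : ℤ) * idot scl c + e + (N / 2 : ℕ)) / (N : ℤ)) % ((q * K : ℕ) : ℤ)).toNat)

/-- `cmodL` lists the residues of `coeffMod`. [folklore] -/
theorem cmodL_eq_ofFn (I : LatticeInstance) [IsZLattice ℝ I.lattice] (q : ℕ) [NeZero q] (v : I.lattice) :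
    cmodL q (List.ofFn fun i => (zBasis I).repr v i) = List.ofFn fun i => (coeffMod (zBasis I) q v i).val := by
  rw [cmodL, List.map_ofFn]
  congr 1; funext i
  show _ = ((((zBasis I).repr v i : ℤ) : ZMod q)).val
  rw [val_intCast_eq]; rfl

/-- `idot` against the scaled point is `numZ`. [folklore] -/
theorem idot_scaled (I : LatticeInstance) [IsZLattice ℝ I.lattice] (t : Fin I.n → ℚ) (v : I.lattice) :
    idot (List.ofFn (scaled t)) (List.ofFn fun i => (zBasis I).repr v i) = numZ I t v := by
  rw [idot_ofFn, numZ, dotProduct]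

/-- **`coarseL` computes the residues of `coarseOfNoise`.** [folklore] -/
theorem coarseL_eq (I : LatticeInstance) [IsZLattice ℝ I.lattice] (q : ℕ) [NeZero q] (N : ℕ)
    (t : Fin I.n → ℚ) (v : I.lattice) (e : ℤ) :
    coarseL q N (List.ofFn (scaled t)) (List.ofFn fun i => (zBasis I).repr v i) e =
      (List.ofFn fun i => ((coarseOfNoise (zBasis I) q N (numZ I t) v e).1 i).val,
        (coarseOfNoise (zBasis I) q N (numZ I t) v e).2.val) := by
  rw [coarseL, cmodL_eq_ofFn, idot_scaled, coarseOfNoise, val_intCast_eq]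

/-- **`fineL` computes the residues of `fineOfNoise`.** [folklore] -/
theorem fineL_eq (I : LatticeInstance) [IsZLattice ℝ I.lattice] (q K : ℕ) [NeZero q] [NeZero K] (N : ℕ)
    (t : Fin I.n → ℚ) (v : I.lattice) (e : ℤ) :
    fineL q K N (List.ofFn (scaled t)) (List.ofFn fun i => (zBasis I).repr v i) e =
      (List.ofFn fun i => ((fineOfNoise (zBasis I) q K N (numZ I t) v e).1 i).val,
        (fineOfNoise (zBasis I) q K N (numZ I t) v e).2.val) := by
  rw [fineL, cmodL_eq_ofFn, idot_scaled, fineOfNoise, val_intCast_eq]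

/-- `cmodL` on codes. [cite: AroraBarak2009, §1.3] -/
theorem codeFP_cmodL : CodeFP (pairE natE (rawE intE)) (rawE natE) (fun p => cmodL p.1 p.2) := by
  have hg : CodeFP (pairE natE intE) natE (fun t => (t.2 % (t.1 : ℤ)).toNat) :=
    (intToNat.comp (intEModOf (snd _ _) (intOfNat.comp (fst _ _))) :)
  exact ((map (σ := ℕ) (eσ := natE) (eα := intE) (g := fun t => (t.2 % (t.1 : ℤ)).toNat) hg)).congr fun _ => rfl

/-- `coarseL` on codes `((q, N), (scl, (c, e)))`. [cite: AroraBarak2009, §1.3] -/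
theorem codeFP_coarseL : CodeFP (pairE (pairE natE natE) (pairE (rawE intE) (pairE (rawE intE) intE)))
    (pairE (rawE natE) natE) (fun p => coarseL p.1.1 p.1.2 p.2.1 p.2.2.1 p.2.2.2) := by
  have hq : CodeFP (pairE (pairE natE natE) (pairE (rawE intE) (pairE (rawE intE) intE))) intE
      (fun p => (p.1.1 : ℤ)) := (intOfNat.comp (fst _ _).fst' :)
  have hN : CodeFP (pairE (pairE natE natE) (pairE (rawE intE) (pairE (rawE intE) intE))) intE
      (fun p => (p.1.2 : ℤ)) := (intOfNat.comp (fst _ _).snd' :)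
  have hh : CodeFP (pairE (pairE natE natE) (pairE (rawE intE) (pairE (rawE intE) intE))) intE
      (fun p => ((p.1.2 / 2 : ℕ) : ℤ)) := (intOfNat.comp (natDiv.comp ((fst _ _).snd'.pair (const _ (2 : ℕ)))) :)
  have hd : CodeFP (pairE (pairE natE natE) (pairE (rawE intE) (pairE (rawE intE) intE))) intE
      (fun p => idot p.2.1 p.2.2.1) := (idot_codeFP.comp ((snd _ _).fst'.pair (snd _ _).snd'.fst') :)
  have he : CodeFP (pairE (pairE natE natE) (pairE (rawE intE) (pairE (rawE intE) intE))) intE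
      (fun p => p.2.2.2) := (snd _ _).snd'.snd'
  have hb : CodeFP (pairE (pairE natE natE) (pairE (rawE intE) (pairE (rawE intE) intE))) natE
      (fun p => (((idot p.2.1 p.2.2.1 + p.2.2.2 + (p.1.2 / 2 : ℕ)) / (p.1.2 : ℤ)) % (p.1.1 : ℤ)).toNat) :=
    (intToNat.comp (intEModOf (intEDiv.comp ((intAdd.comp ((intAdd.comp (hd.pair he)).pair hh)).pair hN)) hq) :)
  exact ((codeFP_cmodL.comp ((fst _ _).fst'.pair (snd _ _).snd'.fst')).pair hb).congr fun _ => rfl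

/-- `fineL` on codes `(((q, K), N), (scl, (c, e)))`. [cite: AroraBarak2009, §1.3] -/
theorem codeFP_fineL : CodeFP (pairE (pairE (pairE natE natE) natE) (pairE (rawE intE) (pairE (rawE intE) intE)))
    (pairE (rawE natE) natE) (fun p => fineL p.1.1.1 p.1.1.2 p.1.2 p.2.1 p.2.2.1 p.2.2.2) := by
  have hqK : CodeFP (pairE (pairE (pairE natE natE) natE) (pairE (rawE intE) (pairE (rawE intE) intE))) intE
      (fun p => ((p.1.1.1 * p.1.1.2 : ℕ) : ℤ)) := (intOfNat.comp (natMul.comp (fst _ _).fst') :)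
  have hK : CodeFP (pairE (pairE (pairE natE natE) natE) (pairE (rawE intE) (pairE (rawE intE) intE))) intE
      (fun p => (p.1.1.2 : ℤ)) := (intOfNat.comp (fst _ _).fst'.snd' :)
  have hN : CodeFP (pairE (pairE (pairE natE natE) natE) (pairE (rawE intE) (pairE (rawE intE) intE))) intE
      (fun p => (p.1.2 : ℤ)) := (intOfNat.comp (fst _ _).snd' :)
  have hh : CodeFP (pairE (pairE (pairE natE natE) natE) (pairE (rawE intE) (pairE (rawE intE) intE))) intE
      (fun p => ((p.1.2 / 2 : ℕ) : ℤ)) := (intOfNat.comp (natDiv.comp ((fst _ _).snd'.pair (const _ (2 : ℕ)))) :)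
  have hd : CodeFP (pairE (pairE (pairE natE natE) natE) (pairE (rawE intE) (pairE (rawE intE) intE))) intE
      (fun p => idot p.2.1 p.2.2.1) := (idot_codeFP.comp ((snd _ _).fst'.pair (snd _ _).snd'.fst') :)
  have he : CodeFP (pairE (pairE (pairE natE natE) natE) (pairE (rawE intE) (pairE (rawE intE) intE))) intE
      (fun p => p.2.2.2) := (snd _ _).snd'.snd'
  have hb : CodeFP (pairE (pairE (pairE natE natE) natE) (pairE (rawE intE) (pairE (rawE intE) intE))) natE
      (fun p => ((((p.1.1.2 : ℤ) * idot p.2.1 p.2.2.1 + p.2.2.2 + (p.1.2 / 2 : ℕ)) / (p.1.2 : ℤ)) %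
        ((p.1.1.1 * p.1.1.2 : ℕ) : ℤ)).toNat) :=
    (intToNat.comp (intEModOf
      (intEDiv.comp ((intAdd.comp ((intAdd.comp ((intMul.comp (hK.pair hd)).pair he)).pair hh)).pair hN)) hqK) :)
  exact ((codeFP_cmodL.comp ((fst _ _).fst'.fst'.pair (snd _ _).snd'.fst')).pair hb).congr fun _ => rfl

/-! ### The samples of a block -/

/-- The coin words of a block component: `k` chunks of width `L`. [cite: AroraBarak2009, Def. 7.1] -/
def wordsL (L k : ℕ) (r : List Bool) : List (List Bool) := List.ofFn fun i : Fin k => chunk L r i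

/-- `wordsL` on codes `(1^L, (1^k, r))`. [cite: AroraBarak2009, §1.3] -/
theorem codeFP_wordsL : CodeFP (pairE unE (pairE unE strE)) (rawE strE) (fun p => wordsL p.1 p.2.1 p.2.2) := by
  refine (strChunks.comp ((snd _ _).fst'.pair ((fst _ _).pair (snd _ _).snd'))).congr fun p => ?_
  rw [wordsL]
  apply List.ext_getElem (by simp)
  intro i h₁ h₂
  simp [chunk, Nat.mul_comm]

/-- **The list of manufactured samples of one kind**: vector `i` (by coordinates) with the noise value the
sampler returns on word `i`. `F` is `coarseL q N` or `fineL q K N`. [cite: RegevLWE2009, Lemma 3.11 (proof)] -/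
def sampleListL (F : List ℤ → List ℤ → ℤ → List ℕ × ℕ) (samp : List Bool → List Bool) (M : ℕ) (s : ℚ) (ℓ L : ℕ)
    (scl : List ℤ) (vecs : List (List ℤ)) (r : List Bool) : List (List ℕ × ℕ) :=
  List.zipWith (fun c word => F scl c (noiseOfBits samp M s ℓ word)) vecs (wordsL L vecs.length r)

/-- `sampleListL` on `ofFn` data. [folklore] -/
theorem sampleListL_ofFn (F : List ℤ → List ℤ → ℤ → List ℕ × ℕ) (samp : List Bool → List Bool) (M : ℕ) (s : ℚ)
    (ℓ L : ℕ) (scl : List ℤ) {k : ℕ} (vecs : Fin k → List ℤ) (r : List Bool) :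
    sampleListL F samp M s ℓ L scl (List.ofFn vecs) r =
      List.ofFn fun i => F scl (vecs i) (noiseOfBits samp M s ℓ (chunk L r i)) := by
  rw [sampleListL, List.length_ofFn, wordsL, zipWith_ofFn]

/-- **The list program of one block**: shift from the first `ℓU·n` coins, coarse samples from the next
`Lc·m`, fine samples from the rest (`m`, `N_V` = the numbers of vectors supplied).
[cite: RegevLWE2009, Lemma 3.11 (proof) with Lemma 3.7 (proof)] -/
def blockL (samp : List Bool → List Bool) (q K n N Mc Mf : ℕ) (sc sf : ℚ) (ℓU Lc Lf : ℕ) (scl : List ℤ)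
    (cvecs fvecs : List (List ℤ)) (r : List Bool) : (List ℕ × List (List ℕ × ℕ)) × List (List ℕ × ℕ) :=
  ((shiftL n q ℓU (r.take (ℓU * n)),
    sampleListL (coarseL q N) samp Mc sc n Lc scl cvecs ((r.drop (ℓU * n)).take (Lc * cvecs.length))),
    sampleListL (fineL q K N) samp Mf sf n Lf scl fvecs (r.drop (ℓU * n + Lc * cvecs.length)))

/-- The residue lists of block data. [folklore] -/
def valsOf {n q K m NV : ℕ}
    (D : ((Fin n → ZMod q) × (Fin m → (Fin n → ZMod q) × ZMod q)) × (Fin NV → (Fin n → ZMod q) × ZMod (q * K))) :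
    (List ℕ × List (List ℕ × ℕ)) × List (List ℕ × ℕ) :=
  ((List.ofFn fun i => (D.1.1 i).val,
    List.ofFn fun i => (List.ofFn fun l => ((D.1.2 i).1 l).val, (D.1.2 i).2.val)),
    List.ofFn fun i => (List.ofFn fun l => ((D.2 i).1 l).val, (D.2 i).2.val))

/-- **The block list program computes the residues of `blockOfBits`.**
[cite: RegevLWE2009, Lemma 3.11 (proof) with Lemma 3.7 (proof)] -/
theorem blockL_eq (I : LatticeInstance) [IsZLattice ℝ I.lattice] (q K m NV : ℕ) [NeZero q] [NeZero K]
    (samp : List Bool → List Bool) (pc : Polynomial ℕ) (Mc : ℕ) (sc : ℚ) (Mf : ℕ) (sf : ℚ) (ℓU N : ℕ)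
    (t : Fin I.n → ℚ) (u : Fin (m + NV) → I.lattice) (r : List Bool) :
    blockL samp q K I.n N Mc Mf sc sf ℓU (coinLen pc Mc sc I.n) (coinLen pc Mf sf I.n) (List.ofFn (scaled t))
        (List.ofFn fun i : Fin m => List.ofFn fun l => (zBasis I).repr (u (Fin.castAdd NV i)) l)
        (List.ofFn fun i : Fin NV => List.ofFn fun l => (zBasis I).repr (u (Fin.natAdd m i)) l) r =
      valsOf (blockOfBits (zBasis I) q K m NV samp pc Mc sc I.n Mf sf I.n ℓU N (numZ I t) u r) := by
  simp only [blockL, valsOf, blockOfBits, blockOfWords, List.length_ofFn, sampleListL_ofFn, shiftL_eq_ofFn,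
    coarseL_eq, fineL_eq]

/-! ### The secret shift of the coarse batch -/

/-- **The shifted coarse batch** `(a, b + ⟨a, s⟩)` as residues. [cite: RegevLWE2009, Lemma 4.1 (proof)] -/
def shiftedL (q : ℕ) (s : List ℕ) (cs : List (List ℕ × ℕ)) : List (List ℕ × ℕ) :=
  cs.map fun ab => (ab.1, (ab.2 + dotN ab.1 s) % q)

/-- `shiftedL` computes the residues of `shiftSample s ∘ S`. [folklore] -/
theorem shiftedL_ofFn {n q m : ℕ} [NeZero q] (s : Fin n → ZMod q) (S : Fin m → (Fin n → ZMod q) × ZMod q) :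
    shiftedL q (List.ofFn fun i => (s i).val) (List.ofFn fun j => (List.ofFn fun i => ((S j).1 i).val, (S j).2.val)) =
      List.ofFn fun j => (List.ofFn fun i => (((shiftSample s ∘ S) j).1 i).val, ((shiftSample s ∘ S) j).2.val) := by
  rw [shiftedL, List.map_ofFn]
  congr 1; funext j
  simp only [Function.comp_apply, shiftSample, dotN_ofFn, val_add_dotProduct]

/-- `shiftedL` on codes `(q, (s, cs))`. [cite: AroraBarak2009, §1.3] -/
theorem codeFP_shiftedL : CodeFP (pairE natE (pairE (rawE natE) (rawE (pairE (rawE natE) natE))))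
    (rawE (pairE (rawE natE) natE)) (fun p => shiftedL p.1 p.2.1 p.2.2) := by
  have hg : CodeFP (pairE (pairE natE (rawE natE)) (pairE (rawE natE) natE)) (pairE (rawE natE) natE)
      (fun t => (t.2.1, (t.2.2 + dotN t.2.1 t.1.2) % t.1.1)) :=
    (snd _ _).fst'.pair (natMod.comp ((natAdd.comp ((snd _ _).snd'.pair
      (codeFP_dotN.comp ((snd _ _).fst'.pair (fst _ _).snd')))).pair (fst _ _).fst'))
  exact ((map (σ := ℕ × List ℕ) (eσ := pairE natE (rawE natE)) (eα := pairE (rawE natE) natE)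
    (g := fun t => (t.2.1, (t.2.2 + dotN t.2.1 t.1.2) % t.1.1)) hg).comp
    (((fst _ _).pair (snd _ _).fst').pair (snd _ _).snd')).congr fun _ => rfl

/-! ### The LWE code of a batch -/

/-- The code of a vector encoding. [folklore] -/
theorem encodingFinVec_encode (e : Encoding α Bool) (m : ℕ) (v : Fin m → α) :
    (encodingFinVec e m).encode v = listE e.encode (List.ofFn v) := by
  rw [← listE_eq]; rfl

/-- **The LWE code of a batch is the typed code of `(n, q, residue lists)`.** [cite: Regev2009, §2] -/
theorem encodeLWESamples_eq {n q m : ℕ} (S : Fin m → (Fin n → ZMod q) × ZMod q) :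
    encodeLWESamples S = pairE natE (pairE natE (listE (pairE (listE natE) natE)))
      (n, q, List.ofFn fun j => (List.ofFn fun i => ((S j).1 i).val, (S j).2.val)) := by
  have hitem : ∀ j : Fin m, ((encodingFinVec encodingNatBool n).pairBool encodingNatBool).encode
      (fun i => ((S j).1 i).val, ((S j).2).val) =
      pairE (listE natE) natE (List.ofFn fun i => ((S j).1 i).val, (S j).2.val) := fun j => by
    rw [pairE_eq, pairE_apply, pairE_apply, encodingFinVec_encode]; rfl
  have hl : listE ((encodingFinVec encodingNatBool n).pairBool encodingNatBool).encode
      (List.ofFn fun j => (fun i => ((S j).1 i).val, ((S j).2).val)) =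
      listE (pairE (listE natE) natE) (List.ofFn fun j => (List.ofFn fun i => ((S j).1 i).val, (S j).2.val)) := by
    simp only [listE, List.length_ofFn, rawE, List.map_ofFn]
    exact congrArg _ (congrArg encList (congrArg List.ofFn (funext hitem)))
  rw [encodeLWESamples, encodingFinVec_encode, hl]
  rfl

/-! ### The block program is polynomial-time -/

/-- Parameter code of a block: `((q, K, 1ⁿ, N), (Mc, Mf, sc, sf), (1^ℓU, 1^Lc, 1^Lf))`. [folklore] -/
abbrev bparE : ((ℕ × ℕ × ℕ × ℕ) × (ℕ × ℕ × ℚ × ℚ) × (ℕ × ℕ × ℕ)) → List Bool :=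
  pairE (pairE natE (pairE natE (pairE unE natE)))
    (pairE (pairE natE (pairE natE (pairE encodeRat encodeRat))) (pairE unE (pairE unE unE)))

/-- Vector data code of a block: `(scl, cvecs, fvecs)`. [folklore] -/
abbrev bvecE : (List ℤ × List (List ℤ) × List (List ℤ)) → List Bool :=
  pairE (rawE intE) (pairE (rawE (rawE intE)) (rawE (rawE intE)))

/-- Output code of a block. [folklore] -/
abbrev boutE : ((List ℕ × List (List ℕ × ℕ)) × List (List ℕ × ℕ)) → List Bool :=
  pairE (pairE (rawE natE) (rawE (pairE (rawE natE) natE))) (rawE (pairE (rawE natE) natE))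

/-- `sampleListL` on codes, for a sample map `F` computed on `(ctx, (scl, (c, e)))`.
[cite: AroraBarak2009, §1.3 (bounded loops)] -/
theorem codeFP_sampleListL {κ : Type} {eκ : κ → List Bool} {F : κ → List ℤ → List ℤ → ℤ → List ℕ × ℕ}
    (hF : CodeFP (pairE eκ (pairE (rawE intE) (pairE (rawE intE) intE))) (pairE (rawE natE) natE)
      (fun p => F p.1 p.2.1 p.2.2.1 p.2.2.2))
    {samp : List Bool → List Bool} (hsamp : samp ∈ FP) :
    CodeFP (pairE eκ (pairE (pairE (pairE natE (pairE encodeRat unE)) unE) (pairE (rawE intE) (pairE (rawE (rawE intE)) strE))))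
      (rawE (pairE (rawE natE) natE))
      (fun p => sampleListL (F p.1) samp p.2.1.1.1 p.2.1.1.2.1 p.2.1.1.2.2 p.2.1.2 p.2.2.1 p.2.2.2.1 p.2.2.2.2) := by
  -- context `σ = (ctx, ((M, s, ℓ), scl))`, items `(c, word)`
  have hg : CodeFP (pairE (pairE eκ (pairE (pairE natE (pairE encodeRat unE)) (rawE intE))) (pairE (rawE intE) strE))
      (pairE (rawE natE) natE)
      (fun t => F t.1.1 t.1.2.2 t.2.1 (noiseOfBits samp t.1.2.1.1 t.1.2.1.2.1 t.1.2.1.2.2 t.2.2)) :=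
    (hF.comp ((fst _ _).fst'.pair ((fst _ _).snd'.snd'.pair ((snd _ _).fst'.pair
      ((codeFP_noise hsamp).comp ((fst _ _).snd'.fst'.pair (snd _ _).snd'))))) :)
  have hz := zipWith (σ := κ × (ℕ × ℚ × ℕ) × List ℤ) (eσ := pairE eκ (pairE (pairE natE (pairE encodeRat unE)) (rawE intE)))
    (eα := rawE intE) (eβ := strE) (eγ := pairE (rawE natE) natE)
    (g := fun t => F t.1.1 t.1.2.2 t.2.1 (noiseOfBits samp t.1.2.1.1 t.1.2.1.2.1 t.1.2.1.2.2 t.2.2)) hg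
  have hw : CodeFP (pairE eκ (pairE (pairE (pairE natE (pairE encodeRat unE)) unE) (pairE (rawE intE) (pairE (rawE (rawE intE)) strE))))
      (rawE strE) (fun p => wordsL p.2.1.2 p.2.2.2.1.length p.2.2.2.2) :=
    (codeFP_wordsL.comp ((snd _ _).fst'.snd'.pair (((ulength (rawE intE)).comp (snd _ _).snd'.snd'.fst').pair
      (snd _ _).snd'.snd'.snd')) :)
  exact (hz.comp ((((fst _ _).pair ((snd _ _).fst'.fst'.pair (snd _ _).snd'.fst'))).pair
    ((snd _ _).snd'.snd'.fst'.pair hw))).congr fun _ => rfl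

/-- **The block list program is polynomial-time** (given a polynomial-time sampler), on
`(params, (vectors, coins))`. [cite: AroraBarak2009, §1.3] -/
theorem codeFP_blockL {samp : List Bool → List Bool} (hsamp : samp ∈ FP) :
    CodeFP (pairE bparE (pairE bvecE strE)) boutE
      (fun x => blockL samp x.1.1.1 x.1.1.2.1 x.1.1.2.2.1 x.1.1.2.2.2 x.1.2.1.1 x.1.2.1.2.1 x.1.2.1.2.2.1 x.1.2.1.2.2.2
        x.1.2.2.1 x.1.2.2.2.1 x.1.2.2.2.2 x.2.1.1 x.2.1.2.1 x.2.1.2.2 x.2.2) := by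
  -- names for the projections
  have pq : CodeFP (pairE bparE (pairE bvecE strE)) natE (fun x => x.1.1.1) := (fst _ _).fst'.fst'
  have pK : CodeFP (pairE bparE (pairE bvecE strE)) natE (fun x => x.1.1.2.1) := (fst _ _).fst'.snd'.fst'
  have pn : CodeFP (pairE bparE (pairE bvecE strE)) unE (fun x => x.1.1.2.2.1) := (fst _ _).fst'.snd'.snd'.fst'
  have pN : CodeFP (pairE bparE (pairE bvecE strE)) natE (fun x => x.1.1.2.2.2) := (fst _ _).fst'.snd'.snd'.snd'
  have pMc : CodeFP (pairE bparE (pairE bvecE strE)) natE (fun x => x.1.2.1.1) := (fst _ _).snd'.fst'.fst'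
  have pMf : CodeFP (pairE bparE (pairE bvecE strE)) natE (fun x => x.1.2.1.2.1) := (fst _ _).snd'.fst'.snd'.fst'
  have psc : CodeFP (pairE bparE (pairE bvecE strE)) encodeRat (fun x => x.1.2.1.2.2.1) :=
    (fst _ _).snd'.fst'.snd'.snd'.fst'
  have psf : CodeFP (pairE bparE (pairE bvecE strE)) encodeRat (fun x => x.1.2.1.2.2.2) :=
    (fst _ _).snd'.fst'.snd'.snd'.snd'
  have pU : CodeFP (pairE bparE (pairE bvecE strE)) unE (fun x => x.1.2.2.1) := (fst _ _).snd'.snd'.fst'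
  have pLc : CodeFP (pairE bparE (pairE bvecE strE)) unE (fun x => x.1.2.2.2.1) := (fst _ _).snd'.snd'.snd'.fst'
  have pLf : CodeFP (pairE bparE (pairE bvecE strE)) unE (fun x => x.1.2.2.2.2) := (fst _ _).snd'.snd'.snd'.snd'
  have pscl : CodeFP (pairE bparE (pairE bvecE strE)) (rawE intE) (fun x => x.2.1.1) := (snd _ _).fst'.fst'
  have pcv : CodeFP (pairE bparE (pairE bvecE strE)) (rawE (rawE intE)) (fun x => x.2.1.2.1) := (snd _ _).fst'.snd'.fst'
  have pfv : CodeFP (pairE bparE (pairE bvecE strE)) (rawE (rawE intE)) (fun x => x.2.1.2.2) := (snd _ _).fst'.snd'.snd'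
  have pr : CodeFP (pairE bparE (pairE bvecE strE)) strE (fun x => x.2.2) := (snd _ _).snd'
  -- the three coin words
  have unMulP : CodeFP (pairE unE unE) unE (fun p => p.1 * p.2) :=
    _root_.Literature.Computability.QuantumComplexity.unMul_codeFP
  have hUn : CodeFP (pairE bparE (pairE bvecE strE)) unE (fun x => x.1.2.2.1 * x.1.1.2.2.1) := (unMulP.comp (pU.pair pn) :)
  have hLm : CodeFP (pairE bparE (pairE bvecE strE)) unE (fun x => x.1.2.2.2.1 * x.2.1.2.1.length) :=
    (unMulP.comp (pLc.pair ((ulength (rawE intE)).comp pcv)) :)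
  have hr1 : CodeFP (pairE bparE (pairE bvecE strE)) strE (fun x => x.2.2.take (x.1.2.2.1 * x.1.1.2.2.1)) :=
    (strTake.comp (hUn.pair pr) :)
  have hr2 : CodeFP (pairE bparE (pairE bvecE strE)) strE
      (fun x => (x.2.2.drop (x.1.2.2.1 * x.1.1.2.2.1)).take (x.1.2.2.2.1 * x.2.1.2.1.length)) :=
    (strTake.comp (hLm.pair (strDrop.comp (hUn.pair pr))) :)
  have hr3 : CodeFP (pairE bparE (pairE bvecE strE)) strE
      (fun x => x.2.2.drop (x.1.2.2.1 * x.1.1.2.2.1 + x.1.2.2.2.1 * x.2.1.2.1.length)) :=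
    (strDrop.comp ((unAdd.comp (hUn.pair hLm)).pair pr) :)
  -- shift
  have hs : CodeFP (pairE bparE (pairE bvecE strE)) (rawE natE)
      (fun x => shiftL x.1.1.2.2.1 x.1.1.1 x.1.2.2.1 (x.2.2.take (x.1.2.2.1 * x.1.1.2.2.1))) :=
    (codeFP_shiftL.comp ((pn.pair pq).pair (pU.pair hr1)) :)
  -- coarse and fine sample lists
  have hFc : CodeFP (pairE (pairE natE natE) (pairE (rawE intE) (pairE (rawE intE) intE))) (pairE (rawE natE) natE)
      (fun p => coarseL p.1.1 p.1.2 p.2.1 p.2.2.1 p.2.2.2) := codeFP_coarseL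
  have hc := (codeFP_sampleListL (κ := ℕ × ℕ) (eκ := pairE natE natE) (F := fun c => coarseL c.1 c.2) hFc hsamp).comp
    ((pq.pair pN).pair ((((pMc.pair (psc.pair pn)).pair pLc)).pair (pscl.pair (pcv.pair hr2))))
  have hFf : CodeFP (pairE (pairE (pairE natE natE) natE) (pairE (rawE intE) (pairE (rawE intE) intE)))
      (pairE (rawE natE) natE) (fun p => fineL p.1.1.1 p.1.1.2 p.1.2 p.2.1 p.2.2.1 p.2.2.2) := codeFP_fineL
  have hf := (codeFP_sampleListL (κ := (ℕ × ℕ) × ℕ) (eκ := pairE (pairE natE natE) natE)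
    (F := fun c => fineL c.1.1 c.1.2 c.2) hFf hsamp).comp
    (((pq.pair pK).pair pN).pair ((((pMf.pair (psf.pair pn)).pair pLf)).pair (pscl.pair (pfv.pair hr3))))
  exact ((hs.pair hc).pair hf).congr fun _ => rfl

end CVPqProg

end Regev2009

end Literature.Computability.Cryptography
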